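import Mathlib
import Literature.Computability.Complexity.RangeAvoidance
import Literature.Computability.Complexity.SignDegreeXor
import Summits.PneNP.PneNP.Theorems.PstarPairwise
import Summits.PneNP.PneNP.Theorems.PstarTyped
import Summits.PneNP.PneNP.Theorems.PairwiseSALevel
import Summits.PneNP.PneNP.Theorems.PstarIP3Law
import Summits.PneNP.PneNP.Theorems.SASubThreshold

/-!
# T23.1-C `TypedPairwiseLaws`: the typed `P⋆` fibre laws in the hub's format (cell `pnp-ideate`, ROUND-23)

FRONTIER range-avoidance ladder, rung F-N3 context (restricted-model lower bounds; nothing here bears on `P` vs `NP`).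
Closes `SASubThreshold.TypedPairwiseLaws` BY NAME (`typedPairwiseLaws`): every TYPED pure-`P⋆` instance `I` (no variable is
both an XOR-slot and an AND-slot variable, `PstarTyped.Typed`) carries, for every target `y`, pairwise-independent fibre laws
with VARIABLE-CONSISTENT biases in the sense of `PairwiseSALevel.PairwiseLaws`: the law of output `j` is the ROUND-13/21
LP-point distribution `PstarPairwise.lp (√2/2) (y j)` (`u₀` uniform, `u₂,u₃` i.i.d. with bias `1/√2`, `u₁ := u₀ ⊕ u₂u₃ ⊕ y j`),
and the bias of a variable is `typedBias I v = √2/2` if `v` occurs in some AND slot, `1/2` otherwise — typedness makes every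
XOR-slot variable land on `1/2` (`typedBias_of_xor`).  Marginals: `pr1_lp` (all four slots, both values); independence:
`PstarPairwise.pairwiseIndep_lp` (the XOR pair needs `2r² = 1`: `u₂ ∧ u₃` is a fair coin).  Feeds
`SASubThreshold.pstarSASubThresholdBlind_of` (HEADLINE-23-B) together with the hub and `PstarExpandingDensity`.
-/

set_option linter.dupNamespace false

open Finset
open Literature.Computability.Complexity
open Summit.PneNP.PneNP.Theorems.PstarPairwise
open Summit.PneNP.PneNP.Theorems.PstarTyped (Typed)
open Summit.PneNP.PneNP.Theorems.PairwiseSALevel (marg1 marg2 PairwiseLaws marg1_eq_pr1 marg2_eq_pr2)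
open Summit.PneNP.PneNP.Theorems.PstarIP3Law (rhalf_spec)

namespace Summit.PneNP.PneNP.Theorems.PstarTypedLaws

variable {n m : ℕ}

/-! ## All one-slot marginals of `lp r s` -/

/-- The complementary one-slot marginal. -/
theorem pr1_false_eq (w : (Fin 4 → Bool) → ℝ) (i : Fin 4) : pr1 w i false = (∑ u, w u) - pr1 w i true := by
  unfold pr1
  rw [eq_sub_iff_add_eq, ← Finset.sum_add_distrib]
  refine Finset.sum_congr rfl fun u _ => ?_
  cases u i <;> simp

/-- The one-slot marginals of `lp r s`: XOR slots `0,1` have bias `1/2`, AND slots `2,3` have bias `r`. -/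
theorem pr1_lp (r : ℝ) (s : Bool) (i : Fin 4) (α : Bool) :
    pr1 (lp r s) i α = rho (if 2 ≤ i.val then r else 1 / 2) α := by
  cases α
  · rw [pr1_false_eq, lp_total]
    fin_cases i <;> simp [rho, pr1_lp_zero, pr1_lp_one, pr1_lp_two, pr1_lp_three]
  · fin_cases i <;> simp [rho, pr1_lp_zero, pr1_lp_one, pr1_lp_two, pr1_lp_three]

/-! ## The typed bias -/

/-- **The typed bias**: `√2/2` on variables occurring in some AND slot (positions `2,3`), `1/2` on all others. -/
noncomputable def typedBias (I : LocalMap 4 n m) (v : Fin n) : ℝ := by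
  classical
  exact if ∃ j : Fin m, ∃ s : Fin 4, 2 ≤ s.val ∧ I.vars j s = v then Real.sqrt 2 / 2 else 1 / 2

/-- AND-slot variables have bias `√2/2`. -/
theorem typedBias_of_and (I : LocalMap 4 n m) (j : Fin m) (s : Fin 4) (hs : 2 ≤ s.val) :
    typedBias I (I.vars j s) = Real.sqrt 2 / 2 := by
  unfold typedBias
  exact if_pos ⟨j, s, hs, rfl⟩

/-- In a TYPED instance XOR-slot variables have bias `1/2`. -/
theorem typedBias_of_xor (I : LocalMap 4 n m) (hT : Typed I) (j : Fin m) (s : Fin 4) (hs : s.val < 2) :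
    typedBias I (I.vars j s) = 1 / 2 := by
  unfold typedBias
  rw [if_neg]
  rintro ⟨j', s', hs', h⟩
  exact hT j j' s s' hs hs' h.symm

/-- The typed bias at slot `s` of output `j` is `√2/2` or `1/2` according to the slot type. -/
theorem typedBias_vars (I : LocalMap 4 n m) (hT : Typed I) (j : Fin m) (s : Fin 4) :
    typedBias I (I.vars j s) = if 2 ≤ s.val then Real.sqrt 2 / 2 else 1 / 2 := by
  by_cases hs : 2 ≤ s.val
  · rw [if_pos hs, typedBias_of_and I j s hs]
  · rw [if_neg hs, typedBias_of_xor I hT j s (by omega)]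

/-- The typed bias is a genuine bias. -/
theorem typedBias_pos (I : LocalMap 4 n m) (v : Fin n) : 0 < typedBias I v := by
  unfold typedBias
  split_ifs
  · exact rhalf_spec.2.1
  · norm_num

/-- The typed bias is a genuine bias. -/
theorem typedBias_lt_one (I : LocalMap 4 n m) (v : Fin n) : typedBias I v < 1 := by
  unfold typedBias
  split_ifs
  · exact rhalf_spec.2.2
  · norm_num

/-! ## The laws -/

/-- **The typed fibre laws are pairwise laws**: biases `typedBias I`, law of output `j` = `lp (√2/2) (y j)`. -/
theorem pairwiseLaws_typed (I : LocalMap 4 n m) (hP : I.IsPure xorAndPred) (hT : Typed I) (y : Fin m → Bool) :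
    PairwiseLaws I y (typedBias I) (fun j => lp (Real.sqrt 2 / 2) (y j)) := by
  obtain ⟨hr, h0, h1⟩ := rhalf_spec
  refine ⟨typedBias_pos I, typedBias_lt_one I, fun j u => lp_nonneg h0.le h1.le _ _, fun j => lp_total _ _,
    fun j u hu => ?_, fun j s α => ?_, fun j s s' hss α β => ?_⟩
  · rw [hP.1 j]
    exact lp_support _ _ _ hu
  · show marg1 (lp (Real.sqrt 2 / 2) (y j)) s α = rho (typedBias I (I.vars j s)) α
    rw [marg1_eq_pr1, pr1_lp, typedBias_vars I hT j s]
  · show marg2 (lp (Real.sqrt 2 / 2) (y j)) s s' α β =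
      marg1 (lp (Real.sqrt 2 / 2) (y j)) s α * marg1 (lp (Real.sqrt 2 / 2) (y j)) s' β
    rw [marg2_eq_pr2, marg1_eq_pr1]
    exact pairwiseIndep_lp hr (y j) s s' hss α β

/-- **T23.1-C: `TypedPairwiseLaws` holds** (closes `SASubThreshold.TypedPairwiseLaws` by name). -/
theorem typedPairwiseLaws : SASubThreshold.TypedPairwiseLaws :=
  fun _ _ I hP hT y => ⟨_, _, pairwiseLaws_typed I hP hT y⟩

end Summit.PneNP.PneNP.Theorems.PstarTypedLaws
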